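import Mathlib
import Summits.AtomisticToContinuum.FouriersLaw.Theorems.EmbeddedDrudeMourreKineticConductivityFiniteFormDomain
import Summits.AtomisticToContinuum.FouriersLaw.Theorems.EmbeddedDrudeMourreMourreDissolutionLevelShiftPushforward
import Summits.AtomisticToContinuum.FouriersLaw.Theorems.EmbeddedDrudeMourreFGRGapBranchC
import HarnessLib

/-!
# `MourreDissolution`, line `swap-odd-threshold-rigidity`, stub TZ `stub_fibreTwoZeroFloor` — part A

Helper file (supports crux item `stmt-AtomisticToContinuum-12594`, route `EmbeddedDrudeMourre`,
sub-problem `FouriersLaw`; lead c8). Two inputs of the uniform two-zero floor of the resonance function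
`Ω` along its `k₂`-fibres:

* `nearZero_*` — ABSTRACT REAL ANALYSIS: if a `C¹` function `h` has `|h′| ≥ c` wherever `|h| < η` (on a
  window), then every point where `|h| < η` lies within `|h|/c` of a zero of `h` (walk towards decreasing
  `|h|`: `h′` keeps its sign as long as `|h|` stays below `η`; a supremum/IVT argument).
* `fibreTwoZeroFloor_floor` — COMPACTNESS: with `H` the global defining function of the collision sheet
  (`stub_resonanceFactorisation`) and `G = ∂H/∂k₂`, the transversality statements TA
  (`stub_sheetTransversal`, off the exchange planes) and TB (`stub_planeTransversal`, on them) say that `H`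
  and `G` have no common zero; on the compact box `[−π,π] × [−3π,3π] × [−π,π]` the continuous function
  `|H| + |G|` is therefore bounded below by some `2η > 0`, i.e. `|H| < η ⇒ |G| ≥ η` there.

References: Aoki–Lukkarinen–Spohn 2006 §4 (the resonant manifold of the pinned chain); folklore real
analysis.
-/

noncomputable section

open Set Real

namespace Summit.AtomisticToContinuum.FouriersLaw.Theorems.MourreDissolution

open Literature.MathematicalPhysics.KineticTheory.PhononBoltzmann

/-! ## 1. Small values of a transversal function sit next to its zeros -/

/-- Core one-sided case: `0 < h x₀ < η`, `h′ x₀ > 0`, and `|h′| ≥ c` wherever `|h| < η` on the window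
`[x₀ − h x₀/c, x₀]`; then `h` has a zero in that window. Proof: otherwise `h > 0` on the window (IVT);
if `h < η` throughout, `h′ ≥ c` throughout (constant sign) and the mean value inequality forces
`h(x₀ − h x₀/c) ≤ 0`; otherwise the last point `x₁` with `h x₁ ≥ η` has `h` increasing on `[x₁, x₀]`,
contradicting `h x₀ < η`. [folklore] -/
theorem nearZero_core {h g : ℝ → ℝ} {x₀ η c : ℝ} (hc : 0 < c)
    (hderiv : ∀ x, HasDerivAt h (g x) x) (hg : Continuous g)
    (hx₀ : 0 < h x₀) (hη : h x₀ < η) (hgpos : 0 < g x₀)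
    (hsmall : ∀ x ∈ Icc (x₀ - h x₀ / c) x₀, |h x| < η → c ≤ |g x|) :
    ∃ z ∈ Icc (x₀ - h x₀ / c) x₀, h z = 0 := by
  set r := h x₀ / c with hr
  have hr0 : 0 < r := div_pos hx₀ hc
  have hcont : Continuous h := continuous_iff_continuousAt.2 fun x => (hderiv x).continuousAt
  by_contra hne
  push Not at hne
  -- `h > 0` on the window
  have hpos : ∀ x ∈ Icc (x₀ - r) x₀, 0 < h x := by
    intro x hx
    by_contra hle
    push Not at hle
    obtain ⟨z, hz, hz0⟩ :=
      intermediate_value_Icc hx.2 hcont.continuousOn (show (0 : ℝ) ∈ Icc (h x) (h x₀) from ⟨hle, hx₀.le⟩)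
    exact hne z ⟨le_trans hx.1 hz.1, hz.2⟩ hz0
  -- sign of `g` on a sub-window where `0 < h < η`
  have gpos_of : ∀ a, x₀ - r ≤ a → (∀ x ∈ Ioc a x₀, h x < η) → ∀ x ∈ Ioc a x₀, c ≤ g x := by
    intro a ha hlt x hx
    have hxI : x ∈ Icc (x₀ - r) x₀ := ⟨le_trans ha hx.1.le, hx.2⟩
    have habs : |h x| < η := by
      rw [abs_of_pos (hpos x hxI)]; exact hlt x hx
    have hcg := hsmall x hxI habs
    -- `g` does not vanish on `[x, x₀]`, hence keeps the sign of `g x₀ > 0`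
    by_contra hlt'
    push Not at hlt'
    have hgx : g x < 0 := by
      rcases le_or_gt 0 (g x) with h0 | h0
      · rw [abs_of_nonneg h0] at hcg; exact absurd hcg (not_le.2 hlt')
      · exact h0
    obtain ⟨y, hy, hy0⟩ :=
      intermediate_value_Icc hx.2 hg.continuousOn (show (0 : ℝ) ∈ Icc (g x) (g x₀) from ⟨hgx.le, hgpos.le⟩)
    have hyI : y ∈ Icc (x₀ - r) x₀ := ⟨le_trans hxI.1 hy.1, hy.2⟩
    have hyw : y ∈ Ioc a x₀ := ⟨lt_of_lt_of_le hx.1 hy.1, hy.2⟩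
    have habs' : |h y| < η := by rw [abs_of_pos (hpos y hyI)]; exact hlt y hyw
    have := hsmall y hyI habs'
    rw [hy0, abs_zero] at this
    exact absurd this (not_le.2 hc)
  by_cases hT : ∃ x ∈ Icc (x₀ - r) x₀, η ≤ h x
  · -- the last point where `h ≥ η`
    set S : Set ℝ := {x | x ∈ Icc (x₀ - r) x₀ ∧ η ≤ h x} with hS
    have hSne : S.Nonempty := by obtain ⟨x, hx, hxη⟩ := hT; exact ⟨x, hx, hxη⟩
    have hSbdd : BddAbove S := ⟨x₀, fun x hx => hx.1.2⟩
    have hSclosed : IsClosed S := by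
      have hS' : S = Icc (x₀ - r) x₀ ∩ h ⁻¹' Ici η := by
        ext x; simp only [hS, mem_setOf_eq, mem_inter_iff, mem_preimage, mem_Ici]
      rw [hS']; exact isClosed_Icc.inter (isClosed_Ici.preimage hcont)
    have hx₁S : sSup S ∈ S := hSclosed.csSup_mem hSne hSbdd
    set x₁ := sSup S with hx₁
    have hx₁le : x₁ ≤ x₀ := hx₁S.1.2
    have hx₁lt : x₁ < x₀ := by
      rcases lt_or_eq_of_le hx₁le with hlt | heq
      · exact hlt
      · exact absurd (heq ▸ hx₁S.2) (not_le.2 hη)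
    have hlt : ∀ x ∈ Ioc x₁ x₀, h x < η := by
      intro x hx
      by_contra hge; push Not at hge
      have hxS : x ∈ S := ⟨⟨le_trans hx₁S.1.1 hx.1.le, hx.2⟩, hge⟩
      exact absurd (le_csSup hSbdd hxS) (not_le.2 hx.1)
    have hgc := gpos_of x₁ hx₁S.1.1 hlt
    -- `h` is monotone on `[x₁, x₀]`
    have hmono : MonotoneOn h (Icc x₁ x₀) := by
      apply monotoneOn_of_deriv_nonneg (convex_Icc x₁ x₀) hcont.continuousOn
      · exact fun x _ => (hderiv x).differentiableAt.differentiableWithinAt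
      · intro x hx
        rw [interior_Icc] at hx
        rw [(hderiv x).deriv]
        exact le_trans hc.le (hgc x ⟨hx.1, hx.2.le⟩)
    have := hmono ⟨le_rfl, hx₁le⟩ ⟨hx₁le, le_rfl⟩ hx₁le
    exact absurd (lt_of_le_of_lt this hη) (not_lt.2 hx₁S.2)
  · push Not at hT
    have hgc := gpos_of (x₀ - r) le_rfl fun x hx => hT x ⟨hx.1.le, hx.2⟩
    -- mean value inequality on `[x₀ - r, x₀]`
    have hmv := (convex_Icc (x₀ - r) x₀).mul_sub_le_image_sub_of_le_deriv hcont.continuousOn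
      (fun x _ => (hderiv x).differentiableAt.differentiableWithinAt)
      (fun x hx => by
        rw [interior_Icc] at hx
        rw [(hderiv x).deriv]
        exact hgc x ⟨hx.1, hx.2.le⟩)
      (x₀ - r) ⟨le_rfl, by linarith⟩ x₀ ⟨by linarith, le_rfl⟩ (by linarith)
    have hcr : c * (x₀ - (x₀ - r)) = h x₀ := by
      rw [show c * (x₀ - (x₀ - r)) = c * r by ring, hr, mul_div_cancel₀ _ hc.ne']
    rw [hcr] at hmv
    have := hpos (x₀ - r) ⟨le_rfl, by linarith⟩
    linarith

/-- Positive case, either sign of the derivative: `0 < h x₀ < η` and `|h′| ≥ c` wherever `|h| < η` on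
`[x₀ − h x₀/c, x₀ + h x₀/c]` give a zero `z` with `|x₀ − z| ≤ h x₀/c` (for `h′ x₀ < 0` apply the core
case to `x ↦ h(2x₀ − x)`). [folklore] -/
theorem nearZero_pos {h g : ℝ → ℝ} {x₀ η c : ℝ} (hc : 0 < c)
    (hderiv : ∀ x, HasDerivAt h (g x) x) (hg : Continuous g)
    (hx₀ : 0 < h x₀) (hη : h x₀ < η)
    (hsmall : ∀ x ∈ Icc (x₀ - h x₀ / c) (x₀ + h x₀ / c), |h x| < η → c ≤ |g x|) :
    ∃ z, h z = 0 ∧ |x₀ - z| ≤ h x₀ / c := by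
  have hr0 : 0 < h x₀ / c := div_pos hx₀ hc
  have hg0 : g x₀ ≠ 0 := by
    have h1 := hsmall x₀ ⟨by linarith, by linarith⟩ (by rw [abs_of_pos hx₀]; exact hη)
    intro h0; rw [h0, abs_zero] at h1; exact absurd h1 (not_le.2 hc)
  rcases lt_or_gt_of_ne hg0 with hneg | hposg
  · -- reflect: `h̃ x = h (2x₀ - x)`
    set hh : ℝ → ℝ := fun x => h (2 * x₀ - x) with hhh
    set gg : ℝ → ℝ := fun x => -g (2 * x₀ - x) with hgg
    have hderiv' : ∀ x, HasDerivAt hh (gg x) x := by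
      intro x
      have h1 : HasDerivAt (fun x : ℝ => 2 * x₀ - x) (-1) x := by
        simpa using (hasDerivAt_id x).const_sub (2 * x₀)
      have h2 : HasDerivAt (fun x => h (2 * x₀ - x)) (g (2 * x₀ - x) * -1) x :=
        (hderiv (2 * x₀ - x)).comp x h1
      simpa [hhh, hgg] using h2
    have hg' : Continuous gg := by
      simp only [hgg]; exact (hg.comp (by fun_prop)).neg
    have hx₀' : 0 < hh x₀ := by simp only [hhh]; convert hx₀ using 2; ring
    have hval : hh x₀ = h x₀ := by simp only [hhh]; congr 1; ring
    have hη' : hh x₀ < η := by rw [hval]; exact hη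
    have hgpos' : 0 < gg x₀ := by
      simp only [hgg]
      rw [show 2 * x₀ - x₀ = x₀ by ring]
      linarith
    have hsmall' : ∀ x ∈ Icc (x₀ - hh x₀ / c) x₀, |hh x| < η → c ≤ |gg x| := by
      intro x hx hlt
      rw [hval] at hx
      have hx' : 2 * x₀ - x ∈ Icc (x₀ - h x₀ / c) (x₀ + h x₀ / c) := ⟨by linarith [hx.2], by linarith [hx.1]⟩
      have := hsmall (2 * x₀ - x) hx' (by simpa [hhh] using hlt)
      simpa [hgg, abs_neg] using this
    obtain ⟨z, hz, hz0⟩ := nearZero_core hc hderiv' hg' hx₀' hη' hgpos' hsmall'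
    rw [hval] at hz
    refine ⟨2 * x₀ - z, by simpa [hhh] using hz0, ?_⟩
    rw [abs_le]; constructor <;> linarith [hz.1, hz.2]
  · obtain ⟨z, hz, hz0⟩ := nearZero_core hc hderiv hg hx₀ hη hposg
      (fun x hx hlt => hsmall x ⟨hx.1, by linarith [hx.2]⟩ hlt)
    refine ⟨z, hz0, ?_⟩
    rw [abs_le]; constructor <;> linarith [hz.1, hz.2]

/-- **Small values sit next to zeros.** If `h` is `C¹` with `|h′| ≥ c` wherever `|h| < η` on the window
`[x₀ − |h x₀|/c, x₀ + |h x₀|/c]` and `|h x₀| < η`, then `h` has a zero `z` with `|x₀ − z| ≤ |h x₀|/c`.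
[folklore] -/
theorem nearZero {h g : ℝ → ℝ} {x₀ η c : ℝ} (hc : 0 < c)
    (hderiv : ∀ x, HasDerivAt h (g x) x) (hg : Continuous g)
    (hη : |h x₀| < η)
    (hsmall : ∀ x ∈ Icc (x₀ - |h x₀| / c) (x₀ + |h x₀| / c), |h x| < η → c ≤ |g x|) :
    ∃ z, h z = 0 ∧ |x₀ - z| ≤ |h x₀| / c := by
  rcases lt_trichotomy (h x₀) 0 with hneg | h0 | hposv
  · -- apply the positive case to `-h`
    have hderiv' : ∀ x, HasDerivAt (fun x => -h x) ((fun x => -g x) x) x := fun x => (hderiv x).neg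
    have habs : |h x₀| = -h x₀ := abs_of_neg hneg
    rw [habs] at hη hsmall
    have hx₀' : 0 < (fun x => -h x) x₀ := show 0 < -h x₀ by linarith
    have hη' : (fun x => -h x) x₀ < η := show -h x₀ < η from hη
    have hsmall' : ∀ x ∈ Icc (x₀ - (fun x => -h x) x₀ / c) (x₀ + (fun x => -h x) x₀ / c),
        |(fun x => -h x) x| < η → c ≤ |(fun x => -g x) x| := by
      intro x hx hlt
      have := hsmall x hx (by simpa [abs_neg] using hlt)
      simpa [abs_neg] using this
    obtain ⟨z, hz0, hz⟩ := nearZero_pos hc hderiv' hg.neg hx₀' hη' hsmall'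
    refine ⟨z, ?_, by rw [habs]; exact hz⟩
    have : -h z = 0 := hz0
    linarith
  · exact ⟨x₀, h0, by rw [h0]; simp⟩
  · have habs : |h x₀| = h x₀ := abs_of_pos hposv
    rw [habs] at hη hsmall ⊢
    exact nearZero_pos hc hderiv hg hposv hη hsmall

/-! ## 2. The compactness floor: `|H| < η ⇒ |G| ≥ η` on the box -/

/-- Joint continuity of the sheet function `H(k₁,k₂,k₃)` on `ℝ³`. [folklore] -/
theorem fibreTwoZeroFloor_continuous_sheet (ω₂ : ℝ) :
    Continuous fun p : ℝ × ℝ × ℝ =>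
      ((dispersion ω₂ p.1 * dispersion ω₂ p.2.1 + dispersion ω₂ p.2.2 * dispersion ω₂ (p.1 + p.2.1 - p.2.2) +
              2 * (ω₂ + 2)) * Real.cos ((p.1 + p.2.1) / 2) -
          4 * Real.cos ((p.2.2 - p.1) / 2) * Real.cos ((p.2.1 - p.2.2) / 2)) := by
  have hd := levelShift_continuous_dispersion ω₂
  fun_prop

/-- Joint continuity of `G = ∂H/∂k₂` on `ℝ³` (`ω₂ > 0`). [folklore] -/
theorem fibreTwoZeroFloor_continuous_sheetDeriv {ω₂ : ℝ} (hω : 0 < ω₂) :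
    Continuous fun p : ℝ × ℝ × ℝ =>
      ((dispersion ω₂ p.1 * groupVelocity ω₂ p.2.1 + dispersion ω₂ p.2.2 * groupVelocity ω₂ (p.1 + p.2.1 - p.2.2)) *
              Real.cos ((p.1 + p.2.1) / 2) -
            1 / 2 * (dispersion ω₂ p.1 * dispersion ω₂ p.2.1 + dispersion ω₂ p.2.2 * dispersion ω₂ (p.1 + p.2.1 - p.2.2) +
              2 * (ω₂ + 2)) * Real.sin ((p.1 + p.2.1) / 2) +
          2 * Real.cos ((p.2.2 - p.1) / 2) * Real.sin ((p.2.1 - p.2.2) / 2)) := by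
  have hd := levelShift_continuous_dispersion ω₂
  have hv := FGRGap.FoldJetRigidity.Branch.continuous_groupVelocity hω
  fun_prop

/-- **The compactness floor.** If `H` and `G = ∂H/∂k₂` have no common zero (TA off the exchange planes,
TB on them), then on the box `[−π,π] × [−3π,3π] × [−π,π]` (variables `(k₁, k₂, k₃)`) there is `η > 0` with
`|H| < η ⇒ η ≤ |G|`: the continuous function `|H| + |G|` attains a positive minimum `2η` on the compact
box. [folklore] -/
theorem fibreTwoZeroFloor_floor (ω₂ : ℝ) (hω : 0 < ω₂)
    (hTA : ∃ c : ℝ, 0 < c ∧ ∀ k₁ k₂ k₃ : ℝ,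
      ((dispersion ω₂ k₁ * dispersion ω₂ k₂ + dispersion ω₂ k₃ * dispersion ω₂ (k₁ + k₂ - k₃) +
              2 * (ω₂ + 2)) * Real.cos ((k₁ + k₂) / 2) -
          4 * Real.cos ((k₃ - k₁) / 2) * Real.cos ((k₂ - k₃) / 2)) = 0 →
      Real.sin ((k₃ - k₁) / 2) * Real.sin ((k₂ - k₃) / 2) ≠ 0 →
      c ≤ |((dispersion ω₂ k₁ * groupVelocity ω₂ k₂ + dispersion ω₂ k₃ * groupVelocity ω₂ (k₁ + k₂ - k₃)) *
              Real.cos ((k₁ + k₂) / 2) -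
            1 / 2 * (dispersion ω₂ k₁ * dispersion ω₂ k₂ + dispersion ω₂ k₃ * dispersion ω₂ (k₁ + k₂ - k₃) +
              2 * (ω₂ + 2)) * Real.sin ((k₁ + k₂) / 2) +
          2 * Real.cos ((k₃ - k₁) / 2) * Real.sin ((k₂ - k₃) / 2))|)
    (hTB : ∀ k₁ k₂ k₃ : ℝ,
      ((dispersion ω₂ k₁ * dispersion ω₂ k₂ + dispersion ω₂ k₃ * dispersion ω₂ (k₁ + k₂ - k₃) +
              2 * (ω₂ + 2)) * Real.cos ((k₁ + k₂) / 2) -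
          4 * Real.cos ((k₃ - k₁) / 2) * Real.cos ((k₂ - k₃) / 2)) = 0 →
      Real.sin ((k₃ - k₁) / 2) * Real.sin ((k₂ - k₃) / 2) = 0 →
      ((dispersion ω₂ k₁ * groupVelocity ω₂ k₂ + dispersion ω₂ k₃ * groupVelocity ω₂ (k₁ + k₂ - k₃)) *
              Real.cos ((k₁ + k₂) / 2) -
            1 / 2 * (dispersion ω₂ k₁ * dispersion ω₂ k₂ + dispersion ω₂ k₃ * dispersion ω₂ (k₁ + k₂ - k₃) +
              2 * (ω₂ + 2)) * Real.sin ((k₁ + k₂) / 2) +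
          2 * Real.cos ((k₃ - k₁) / 2) * Real.sin ((k₂ - k₃) / 2)) ≠ 0) :
    ∃ η : ℝ, 0 < η ∧ ∀ k₁ k₂ k₃ : ℝ, k₁ ∈ Icc (-π) π → k₂ ∈ Icc (-(3 * π)) (3 * π) → k₃ ∈ Icc (-π) π →
      |((dispersion ω₂ k₁ * dispersion ω₂ k₂ + dispersion ω₂ k₃ * dispersion ω₂ (k₁ + k₂ - k₃) +
              2 * (ω₂ + 2)) * Real.cos ((k₁ + k₂) / 2) -
          4 * Real.cos ((k₃ - k₁) / 2) * Real.cos ((k₂ - k₃) / 2))| < η →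
      η ≤ |((dispersion ω₂ k₁ * groupVelocity ω₂ k₂ + dispersion ω₂ k₃ * groupVelocity ω₂ (k₁ + k₂ - k₃)) *
              Real.cos ((k₁ + k₂) / 2) -
            1 / 2 * (dispersion ω₂ k₁ * dispersion ω₂ k₂ + dispersion ω₂ k₃ * dispersion ω₂ (k₁ + k₂ - k₃) +
              2 * (ω₂ + 2)) * Real.sin ((k₁ + k₂) / 2) +
          2 * Real.cos ((k₃ - k₁) / 2) * Real.sin ((k₂ - k₃) / 2))| := by
  obtain ⟨c, hc, hTA⟩ := hTA
  set Φ : ℝ × ℝ × ℝ → ℝ := fun p =>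
      |((dispersion ω₂ p.1 * dispersion ω₂ p.2.1 + dispersion ω₂ p.2.2 * dispersion ω₂ (p.1 + p.2.1 - p.2.2) +
              2 * (ω₂ + 2)) * Real.cos ((p.1 + p.2.1) / 2) -
          4 * Real.cos ((p.2.2 - p.1) / 2) * Real.cos ((p.2.1 - p.2.2) / 2))| +
      |((dispersion ω₂ p.1 * groupVelocity ω₂ p.2.1 + dispersion ω₂ p.2.2 * groupVelocity ω₂ (p.1 + p.2.1 - p.2.2)) *
              Real.cos ((p.1 + p.2.1) / 2) -
            1 / 2 * (dispersion ω₂ p.1 * dispersion ω₂ p.2.1 + dispersion ω₂ p.2.2 * dispersion ω₂ (p.1 + p.2.1 - p.2.2) +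
              2 * (ω₂ + 2)) * Real.sin ((p.1 + p.2.1) / 2) +
          2 * Real.cos ((p.2.2 - p.1) / 2) * Real.sin ((p.2.1 - p.2.2) / 2))| with hΦ
  have hΦc : Continuous Φ :=
    ((fibreTwoZeroFloor_continuous_sheet ω₂).abs).add (fibreTwoZeroFloor_continuous_sheetDeriv hω).abs
  set K : Set (ℝ × ℝ × ℝ) := Icc (-π) π ×ˢ (Icc (-(3 * π)) (3 * π) ×ˢ Icc (-π) π) with hK
  have hKc : IsCompact K := isCompact_Icc.prod (isCompact_Icc.prod isCompact_Icc)
  have hKne : K.Nonempty := ⟨(0, 0, 0), by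
    simp only [hK, mem_prod, mem_Icc]; refine ⟨⟨?_, ?_⟩, ⟨?_, ?_⟩, ?_, ?_⟩ <;> linarith [pi_pos]⟩
  obtain ⟨p₀, hp₀K, hmin⟩ := hKc.exists_isMinOn hKne hΦc.continuousOn
  -- the minimum is positive: `H` and `G` have no common zero
  have hΦpos : 0 < Φ p₀ := by
    simp only [hΦ]
    by_cases hH0 : ((dispersion ω₂ p₀.1 * dispersion ω₂ p₀.2.1 + dispersion ω₂ p₀.2.2 * dispersion ω₂ (p₀.1 + p₀.2.1 - p₀.2.2) +
              2 * (ω₂ + 2)) * Real.cos ((p₀.1 + p₀.2.1) / 2) -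
          4 * Real.cos ((p₀.2.2 - p₀.1) / 2) * Real.cos ((p₀.2.1 - p₀.2.2) / 2)) = 0
    · have hG0 : ((dispersion ω₂ p₀.1 * groupVelocity ω₂ p₀.2.1 + dispersion ω₂ p₀.2.2 * groupVelocity ω₂ (p₀.1 + p₀.2.1 - p₀.2.2)) *
              Real.cos ((p₀.1 + p₀.2.1) / 2) -
            1 / 2 * (dispersion ω₂ p₀.1 * dispersion ω₂ p₀.2.1 + dispersion ω₂ p₀.2.2 * dispersion ω₂ (p₀.1 + p₀.2.1 - p₀.2.2) +
              2 * (ω₂ + 2)) * Real.sin ((p₀.1 + p₀.2.1) / 2) +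
          2 * Real.cos ((p₀.2.2 - p₀.1) / 2) * Real.sin ((p₀.2.1 - p₀.2.2) / 2)) ≠ 0 := by
        by_cases hσ : Real.sin ((p₀.2.2 - p₀.1) / 2) * Real.sin ((p₀.2.1 - p₀.2.2) / 2) = 0
        · exact hTB _ _ _ hH0 hσ
        · intro hG
          have := hTA _ _ _ hH0 hσ
          rw [hG, abs_zero] at this
          exact absurd this (not_le.2 hc)
      exact add_pos_of_nonneg_of_pos (abs_nonneg _) (abs_pos.2 hG0)
    · exact add_pos_of_pos_of_nonneg (abs_pos.2 hH0) (abs_nonneg _)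
  refine ⟨Φ p₀ / 2, by positivity, fun k₁ k₂ k₃ hk₁ hk₂ hk₃ hH => ?_⟩
  have hmem : ((k₁, k₂, k₃) : ℝ × ℝ × ℝ) ∈ K := by
    simp only [hK, mem_prod]; exact ⟨hk₁, hk₂, hk₃⟩
  have hle : Φ p₀ ≤ Φ (k₁, k₂, k₃) := hmin hmem
  simp only [hΦ] at hle hH ⊢
  linarith [hle, hH]

/-- **Registered helper (TZ part A): the compactness floor in closed form** — `fibreTwoZeroFloor_floor`
with all arguments universally quantified (the shape registered on the crux item). [folklore] -/
theorem fibreTwoZeroFloor_compactnessFloor :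
    ∀ ω₂ : ℝ, 0 < ω₂ →
    (∃ c : ℝ, 0 < c ∧ ∀ k₁ k₂ k₃ : ℝ,
      ((dispersion ω₂ k₁ * dispersion ω₂ k₂ + dispersion ω₂ k₃ * dispersion ω₂ (k₁ + k₂ - k₃) +
              2 * (ω₂ + 2)) * Real.cos ((k₁ + k₂) / 2) -
          4 * Real.cos ((k₃ - k₁) / 2) * Real.cos ((k₂ - k₃) / 2)) = 0 →
      Real.sin ((k₃ - k₁) / 2) * Real.sin ((k₂ - k₃) / 2) ≠ 0 →
      c ≤ |((dispersion ω₂ k₁ * groupVelocity ω₂ k₂ + dispersion ω₂ k₃ * groupVelocity ω₂ (k₁ + k₂ - k₃)) *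
              Real.cos ((k₁ + k₂) / 2) -
            1 / 2 * (dispersion ω₂ k₁ * dispersion ω₂ k₂ + dispersion ω₂ k₃ * dispersion ω₂ (k₁ + k₂ - k₃) +
              2 * (ω₂ + 2)) * Real.sin ((k₁ + k₂) / 2) +
          2 * Real.cos ((k₃ - k₁) / 2) * Real.sin ((k₂ - k₃) / 2))|) →
    (∀ k₁ k₂ k₃ : ℝ,
      ((dispersion ω₂ k₁ * dispersion ω₂ k₂ + dispersion ω₂ k₃ * dispersion ω₂ (k₁ + k₂ - k₃) +
              2 * (ω₂ + 2)) * Real.cos ((k₁ + k₂) / 2) -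
          4 * Real.cos ((k₃ - k₁) / 2) * Real.cos ((k₂ - k₃) / 2)) = 0 →
      Real.sin ((k₃ - k₁) / 2) * Real.sin ((k₂ - k₃) / 2) = 0 →
      ((dispersion ω₂ k₁ * groupVelocity ω₂ k₂ + dispersion ω₂ k₃ * groupVelocity ω₂ (k₁ + k₂ - k₃)) *
              Real.cos ((k₁ + k₂) / 2) -
            1 / 2 * (dispersion ω₂ k₁ * dispersion ω₂ k₂ + dispersion ω₂ k₃ * dispersion ω₂ (k₁ + k₂ - k₃) +
              2 * (ω₂ + 2)) * Real.sin ((k₁ + k₂) / 2) +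
          2 * Real.cos ((k₃ - k₁) / 2) * Real.sin ((k₂ - k₃) / 2)) ≠ 0) →
    ∃ η : ℝ, 0 < η ∧ ∀ k₁ k₂ k₃ : ℝ, k₁ ∈ Set.Icc (-Real.pi) Real.pi →
      k₂ ∈ Set.Icc (-(3 * Real.pi)) (3 * Real.pi) → k₃ ∈ Set.Icc (-Real.pi) Real.pi →
      |((dispersion ω₂ k₁ * dispersion ω₂ k₂ + dispersion ω₂ k₃ * dispersion ω₂ (k₁ + k₂ - k₃) +
              2 * (ω₂ + 2)) * Real.cos ((k₁ + k₂) / 2) -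
          4 * Real.cos ((k₃ - k₁) / 2) * Real.cos ((k₂ - k₃) / 2))| < η →
      η ≤ |((dispersion ω₂ k₁ * groupVelocity ω₂ k₂ + dispersion ω₂ k₃ * groupVelocity ω₂ (k₁ + k₂ - k₃)) *
              Real.cos ((k₁ + k₂) / 2) -
            1 / 2 * (dispersion ω₂ k₁ * dispersion ω₂ k₂ + dispersion ω₂ k₃ * dispersion ω₂ (k₁ + k₂ - k₃) +
              2 * (ω₂ + 2)) * Real.sin ((k₁ + k₂) / 2) +
          2 * Real.cos ((k₃ - k₁) / 2) * Real.sin ((k₂ - k₃) / 2))| :=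
  fun ω₂ hω hTA hTB => fibreTwoZeroFloor_floor ω₂ hω hTA hTB

end Summit.AtomisticToContinuum.FouriersLaw.Theorems.MourreDissolution

end
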